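import Summits.Ventures.PercRepro.RankLevelSetDepCountHeavyB
import Summits.Ventures.PercRepro.RankLevelSetLevelSixHeavyCell
import Summits.Ventures.PercRepro.RankLevelSetPlaneTenPrime

/-!
# PercRepro — THE UNIQUE HEAVY FLAT: `|UG| ≤ f(q)` when `2ν₁ ≥ d + c′ + 1` (p8 g3, S3)

`proofs/SUBCLAIM-S3-p8.md` §3k. In the heavy / light split (RankLevelSetDepCountHeavyB) the good heavy rank-`q` flats
are bounded through their UNION `UG`, `|UG| ≤ q + (j + 1)·d − j·ν₁` (`ncard_UG_le`) — at `(p, d) = (39, 41)` with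
`ν₁ = 33` that is `2^{55}` heavy sets. But two rank-`q` flats of nullity `≥ ν₁` meet in nullity `≥ 2ν₁ − d`
(supermodularity and the corank cap); when that exceeds the nullity `c′` of every rank-`≤ q − 1` set of the core, the
intersection has rank `q` and the two flats COINCIDE (`eRk_inter_ge_of_heavy` at `j = 0`, the pattern of
`ncard_UH_le_of_unique`): there is at most ONE heavy flat, `UG` is inside it, and `|UG| ≤ f(q)`
(**`ncard_UG_le_of_unique`**). At `q = 6` the rank-`≤ 5` sets of the core have nullity `≤ 14` (`f(5) ≤ 19`:
**`nullity_cap_core_five`**), so the condition is `2ν₁ ≥ d + 15` and the heavy class has `≤ 2^{min(39, 6 + d)}` sets —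
`2^{39}` against `2^{55}` at `(39, 41)`. Axioms: standard.
-/

open scoped Matroid

namespace PercRepro

namespace Matroid

open Set

variable {α : Type} {M : _root_.Matroid α}

/-- **The good heavy rank-`q` flat is unique when `d + c′ + 1 ≤ 2ν₁`** (two of them would meet in a set of rank
`≤ q − 1` and nullity `≥ 2ν₁ − d > c′`, so in rank `q`, and flats of the same closure coincide): `|UG| ≤ f` when
rank-`≤ q` sets have `≤ f` points. -/
theorem ncard_UG_le_of_unique [M.Finite] {q ν₁ c' d f : ℕ} (hd : M.E.encard = M.eRank + d)
    (hc' : ∀ X ⊆ M.E, M.eRk X ≤ ((q - 1 : ℕ) : ℕ∞) → (X.ncard : ℕ∞) ≤ M.eRk X + c')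
    (hνc : d + c' + 1 ≤ 2 * ν₁)
    (hflat : ∀ X ⊆ M.E, M.eRk X ≤ (q : ℕ∞) → X.ncard ≤ f) :
    (UG M q ν₁).ncard ≤ f := by
  classical
  rcases (goodFlats M q ν₁).eq_empty_or_nonempty with h | ⟨F₀, hF₀⟩
  · unfold UG
    rw [h]
    simp
  · obtain ⟨hF₀E, hF₀c, hrF₀, hνF₀, -⟩ := mem_goodFlats.1 hF₀
    have hF₀fin : F₀.Finite := M.ground_finite.subset hF₀E
    have hsub : UG M q ν₁ ⊆ F₀ := by
      intro x hx
      unfold UG at hx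
      rw [Set.mem_iUnion₂] at hx
      obtain ⟨F, hF, hxF⟩ := hx
      obtain ⟨hFE, hFc, hrF, hνF, -⟩ := mem_goodFlats.1 hF
      have hc'' : ∀ X ⊆ M.E, M.eRk X ≤ ((q - 0 - 1 : ℕ) : ℕ∞) → (X.ncard : ℕ∞) ≤ M.eRk X + c' := by
        intro X hX hr
        exact hc' X hX (by rwa [show q - 0 - 1 = q - 1 by omega] at hr)
      have hi : ((q - 0 : ℕ) : ℕ∞) ≤ M.eRk (F ∩ F₀) :=
        eRk_inter_ge_of_heavy (ρ := q) (j := 0) hd hc'' hνc hFE hF₀E hrF hrF₀ hνF hνF₀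
      rw [Nat.sub_zero] at hi
      have hFfin : F.Finite := M.ground_finite.subset hFE
      have hc₁ : M.closure (F ∩ F₀) = M.closure F :=
        (M.isRkFinite_of_finite (hFfin.subset inter_subset_left)).closure_eq_closure_of_subset_of_eRk_ge_eRk
          inter_subset_left (by rw [hrF]; exact hi)
      have hc₂ : M.closure (F ∩ F₀) = M.closure F₀ :=
        (M.isRkFinite_of_finite (hF₀fin.subset inter_subset_right)).closure_eq_closure_of_subset_of_eRk_ge_eRk
          inter_subset_right (by rw [hrF₀]; exact hi)
      have hFF₀ : F = F₀ := by rw [← hFc, ← hF₀c, ← hc₁, hc₂]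
      rw [← hFF₀]
      exact hxF
    exact (ncard_le_ncard hsub hF₀fin).trans (hflat F₀ hF₀E (le_of_eq hrF₀))

end Matroid

namespace ThmN

open Set

variable {α : Type}

/-- **The rank-`5` nullity cap of the core**: a set of rank `≤ 5` has `|X| ≤ r(X) + 14` (`f(5) ≤ 19` at rank `5`,
`cnull r ≤ 6` below). -/
theorem nullity_cap_core_five (M : Matroid α) [M.Finite]
    (hfree : ∀ e ∈ M.E, ∃ A ⊆ M.E \ {e}, e ∉ M.closure A ∧ e ∉ M.closure ((M.E \ {e}) \ A)) :
    ∀ X ⊆ M.E, M.eRk X ≤ ((6 - 1 : ℕ) : ℕ∞) → (X.ncard : ℕ∞) ≤ M.eRk X + 14 := by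
  intro X hX hr
  obtain ⟨k, hk⟩ := Matroid.exists_eRk_eq_nat (M := M) hX
  rw [hk] at hr ⊢
  have hk5 : k ≤ 5 := by
    have : ((k : ℕ) : ℕ∞) ≤ ((5 : ℕ) : ℕ∞) := by simpa using hr
    exact_mod_cast this
  have hbound : X.ncard ≤ k + 14 := by
    rcases Nat.lt_or_ge k 5 with h | h
    · have h4 := nullity_cap_core M hfree 4 le_rfl X hX (by rw [hk]; exact_mod_cast (by omega : k ≤ 4))
      rw [hk] at h4
      have h4' : X.ncard ≤ k + cnull 4 := by exact_mod_cast h4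
      simp [cnull] at h4'
      omega
    · have h19 := ncard_le_nineteen_of_eRk_le_five_of_free M hfree hX (by rw [hk]; exact_mod_cast hk5)
      omega
  exact_mod_cast hbound

end ThmN

end PercRepro
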